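import Summits.Schanuel.Schanuel.Theorems.RootDecomp1BResFrame03

/-!
# RootDecomp1BResFrame — lens 4, generation 45 «RESULTANT CLEARING: t(1, ρ) = 5 IN EVERY DEGREE» (lane (d) of B-R26/B-R31 (ii); CHECKLIST B-g41 L2128 taken up verbatim, CLAIM L2306, ACK L2307, NODE ≈L2316–L2319; critic VERDICT pending at staging — filed only on GO) — continuation (RootDecomp1BResFrame04): §C cells + §M the member ρ_A

(lens-4 g45 HOME kernel K = HOME/decomp-schanuel-lens-4/g45/ResFrame.lean 9524d315…, 978 l, imports tree `…RootDecomp1BAlgFrame09` + `…RootDecomp1KHyper47`; P ResFrameProbe.lean, C ResFrameCtrl.lean (rc 1 = 17 planted), NODE-g45.md. Port by census-1 gen 19 as `RootDecomp1BResFrame01–04`: 01 = §D the class `AlgUltraLiouvilleIrr` (β ≠ ρ, f irreducible over ℚ, unbounded degree, rate exp(−exp(A^m))) + `algUltraLiouville_sqrt_two` + §A plumbing (first-variable splitting `finSuccEquiv` over ℤ) + §B column-wise Leibniz bounds / Sylvester matrix (`resultant_bounds_cols`); 02 = §E0 the resultant `resX0` eliminating X₀ (`aeval_resX0`, `resX0_ne_zero`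 via `aeval_eq_zero_of_conj_irrQ`, `resX0_bounds`) + §R growth (`kappa1`, `royC_le_exp`, `endgame₄₀`, `Gamma`); 03 = §E THE ENGINE `algebraicIndependent_cons_of_algUltraIrr (hRoy : Roy2014_thm_1_1) (hρ : AlgUltraLiouvilleIrr ρ) : AlgebraicIndependent ℚ (ρ, e, e^ρ, e^i, e^{iρ})` (scoped `maxHeartbeats 1600000` as in K); 04 = §C cells `five_le_polarDeg_one_of_algUltraIrr (hRoy) (hρ) : ((5 : ℕ) : Cardinal) ≤ polarDeg ![(1 : ℝ), ρ]`, swap, surplus/KleinPolar bodies, the four At-cells + §M the named member: `irreducible_fSeq_map`, `algUltraLiouvilleIrr_rhoA` HYP-FREE, `five_le_polarDeg_one_rhoA (hRoy)`, `rhoA_position_irr` — mod `Roy2014_thm_1_1` ONLY (registered, unproved ⇒ binder stays).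
PORT EDITS: the class def's docstring tagged «[class] definition …»; three generic helpers private (`mem_roots_map_iff` — known dedup twin —, `ringHom_mvaeval_int`, `coeff_map_algebraMap_mv`) with per-part private copies; four one-line docstrings added; linter option dropped; statements and proofs verbatim. `--supports stmt-Schanuel-24622`; no census credit carried; rung 0 — nothing here proves Schanuel.)
-/

noncomputable section

open Complex IntermediateField MvPolynomial

namespace Summit.Schanuel.Schanuel.Theorems.RootDecomp1BResFrame

open Summit.Schanuel.Schanuel.Theorems.RootDecomp1EPointTransfer (Roy2014_thm_1_1)
open Summit.Schanuel.Schanuel.Theorems.RootDecomp1KHyper (mvlen mvlen_nonneg abs_coeff_le_mvlen one_le_mvlen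
  exists_ball_eval_ne_zero mvlen_add_le mvlen_mul_le mvlen_C_mul_le mvlen_sum_le mvlen_prod_le mvlen_C mvlen_zero)
open Summit.Schanuel.Schanuel.Theorems.RootDecomp1BHyperFrame (royS framePt Ff Ff_eq_aeval exists_lipschitz_Ff gcoef
  gcoef_ne_zero apply_zero_le_totalDegree linearIndependent_one_irrational)
open Summit.Schanuel.Schanuel.Theorems.RootDecomp1BQuadFrame (qy qe qpt qpt_apply framePt_qy_qe linearIndependent_qpt
  QuadHyperLiouville norm_exp_qpt_le)
open Summit.Schanuel.Schanuel.Theorems.RootDecomp1BAlgFrame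
open Summit.Schanuel.Schanuel.Theorems.RootDecomp1BFedFlagCore (KleinIH polarDeg polarField)
open Summit.Schanuel.Schanuel.Theorems.RootDecomp1BDefectFloorDefs (SharpRelativeLindemannAt TameDefectZeroAt
  WildSharpDefectZeroAt WildSharpDefectZeroInitAt WildSharpInitAt)
open Summit.Schanuel.Schanuel.Theorems.RootDecomp1BDefectFloorCells (natCast_le_trdeg_of_algebraicIndependent)
open Summit.Schanuel.Schanuel.Theorems.RootDecomp1BRadicalDescent (exists_int_relation norm_mvaeval_le_mvlen)
open Summit.Schanuel.Schanuel.Theorems.RootDecomp1BMovingZero (mem_polarField_one mem_polarField_swap)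

/-! ## §C  THE CELLS at `(1 | ρ)`, `ρ ∈ AlgUltraLiouvilleIrr` — modulo Roy's theorem ONLY
(tree texts of `RootDecomp1BQuadFrame05` l.35 / 53 / 59 with `QuadHyperLiouville ↦ AlgUltraLiouvilleIrr` and nothing
else; the X(2) / At-cells in one line each from g40's via the inclusion) -/

section Cells

/-- **`t(r) ≥ 5` (general polar field).**  For `ρ ∈ AlgUltraLiouvilleIrr`, every real tuple `r` whose polar field
contains `ρ, e, e^i, e^ρ, e^{iρ}` has `t(r) ≥ 5` (mod `Roy2014_thm_1_1`). -/
theorem five_le_polarDeg_of_algUltraIrr (hRoy : Roy2014_thm_1_1) {ρ : ℝ} (hρ : AlgUltraLiouvilleIrr ρ)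
    {m : ℕ} {r : Fin m → ℝ} (hρr : (ρ : ℂ) ∈ polarField r) (he : cexp 1 ∈ polarField r)
    (hei : cexp Complex.I ∈ polarField r) (heρ : cexp ρ ∈ polarField r)
    (heρi : cexp (ρ * Complex.I) ∈ polarField r) :
    ((5 : ℕ) : Cardinal) ≤ polarDeg r := by
  have hai := algebraicIndependent_cons_of_algUltraIrr hRoy hρ
  refine natCast_le_trdeg_of_algebraicIndependent (L := polarField r) hai fun i => ?_
  refine Fin.cases ?_ (fun j => ?_) i
  · simpa using hρr
  · simp only [Fin.cons_succ, qpt_apply]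
    fin_cases j
    · simpa using he
    · simpa using heρ
    · simpa using hei
    · simpa using heρi

/-- **`t(1, ρ) ≥ 5` — THE FULL SCHANUEL VALUE of the column `(1 | ρ)`** for `ρ ∈ AlgUltraLiouvilleIrr`
(mod Roy): `ρ, e, e^ρ, e^i, e^{iρ}` are algebraically independent. -/
theorem five_le_polarDeg_one_of_algUltraIrr (hRoy : Roy2014_thm_1_1) {ρ : ℝ} (hρ : AlgUltraLiouvilleIrr ρ) :
    ((5 : ℕ) : Cardinal) ≤ polarDeg ![(1 : ℝ), ρ] := by
  obtain ⟨h1, h2, h3, h4, h5⟩ := mem_polarField_one ρ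
  exact five_le_polarDeg_of_algUltraIrr hRoy hρ h1 h2 h3 h4 h5

/-- … and for the swapped column `(ρ | 1)`. -/
theorem five_le_polarDeg_swap_of_algUltraIrr (hRoy : Roy2014_thm_1_1) {ρ : ℝ} (hρ : AlgUltraLiouvilleIrr ρ) :
    ((5 : ℕ) : Cardinal) ≤ polarDeg ![ρ, (1 : ℝ)] := by
  obtain ⟨h1, h2, h3, h4, h5⟩ := mem_polarField_swap ρ
  exact five_le_polarDeg_of_algUltraIrr hRoy hρ h1 h2 h3 h4 h5

/-- The surplus in the VERBATIM shape of the body of the 1B crux `KleinPolarSchanuel` (item 24622) at `m = 2`,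
`r = (1, ρ)` (`polarDeg` unfolded), with `2 + 2 + 1` on the left. -/
theorem kleinPolarSchanuel_body_two_one_surplus (hRoy : Roy2014_thm_1_1) {ρ : ℝ} (hρ : AlgUltraLiouvilleIrr ρ) :
    ((2 + 2 + 1 : ℕ) : Cardinal) ≤ Algebra.trdeg ℚ ↥(IntermediateField.adjoin ℚ
      (Set.range (Fin.append (fun j => ((![(1 : ℝ), ρ] j : ℝ) : ℂ)) (fun j => ((![(1 : ℝ), ρ] j : ℝ) : ℂ) * Complex.I)) ∪
        Set.range (Complex.exp ∘ Fin.append (fun j => ((![(1 : ℝ), ρ] j : ℝ) : ℂ))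
          (fun j => ((![(1 : ℝ), ρ] j : ℝ) : ℂ) * Complex.I)))) :=
  five_le_polarDeg_one_of_algUltraIrr hRoy hρ

/-- **X(2)(1, ρ)** — g40's storey-2 floor, in one line via the inclusion. -/
theorem four_le_polarDeg_one_of_algUltraIrr (hRoy : Roy2014_thm_1_1) {ρ : ℝ} (hρ : AlgUltraLiouvilleIrr ρ) :
    ((2 + 2 : ℕ) : Cardinal) ≤ polarDeg ![(1 : ℝ), ρ] :=
  four_le_polarDeg_one_of_algUltra hRoy hρ.algUltraLiouville

/-- … swapped. -/
theorem four_le_polarDeg_swap_of_algUltraIrr (hRoy : Roy2014_thm_1_1) {ρ : ℝ} (hρ : AlgUltraLiouvilleIrr ρ) :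
    ((2 + 2 : ℕ) : Cardinal) ≤ polarDeg ![ρ, (1 : ℝ)] :=
  four_le_polarDeg_swap_of_algUltra hRoy hρ.algUltraLiouville

/-- The X(2) floor in the VERBATIM shape of the body of item 24622 at `m = 2`, `r = (1, ρ)` — g40's, via the
inclusion (the 24622-instance of this class is NOT new). -/
theorem kleinPolarSchanuel_body_two_one_algUltraIrr (hRoy : Roy2014_thm_1_1) {ρ : ℝ} (hρ : AlgUltraLiouvilleIrr ρ) :
    ((2 + 2 : ℕ) : Cardinal) ≤ Algebra.trdeg ℚ ↥(IntermediateField.adjoin ℚ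
      (Set.range (Fin.append (fun j => ((![(1 : ℝ), ρ] j : ℝ) : ℂ)) (fun j => ((![(1 : ℝ), ρ] j : ℝ) : ℂ) * Complex.I)) ∪
        Set.range (Complex.exp ∘ Fin.append (fun j => ((![(1 : ℝ), ρ] j : ℝ) : ℂ))
          (fun j => ((![(1 : ℝ), ρ] j : ℝ) : ℂ) * Complex.I)))) :=
  kleinPolarSchanuel_body_two_one_algUltra hRoy hρ.algUltraLiouville

/-- **SRLAt (1 | ρ)** (item 32406 AT `(1 | ρ)`), via the inclusion. -/
theorem sharpRelativeLindemannAt_one_algUltraIrr (hRoy : Roy2014_thm_1_1) {ρ : ℝ} (hρ : AlgUltraLiouvilleIrr ρ) :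
    SharpRelativeLindemannAt 1 ![(1 : ℝ), ρ] :=
  sharpRelativeLindemannAt_one_algUltra hRoy hρ.algUltraLiouville

/-- **T0At (1 | ρ)** (item 32407 AT `(1 | ρ)`), via the inclusion. -/
theorem tameDefectZeroAt_one_algUltraIrr (hRoy : Roy2014_thm_1_1) {ρ : ℝ} (hρ : AlgUltraLiouvilleIrr ρ) :
    TameDefectZeroAt 1 ![(1 : ℝ), ρ] :=
  tameDefectZeroAt_one_algUltra hRoy hρ.algUltraLiouville

/-- **W0At (1 | ρ)** (item 32408 AT `(1 | ρ)`), via the inclusion. -/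
theorem wildSharpDefectZeroAt_one_algUltraIrr (hRoy : Roy2014_thm_1_1) {ρ : ℝ} (hρ : AlgUltraLiouvilleIrr ρ) :
    WildSharpDefectZeroAt 1 ![(1 : ℝ), ρ] :=
  wildSharpDefectZeroAt_one_algUltra hRoy hρ.algUltraLiouville

/-- **W0InitAt (1 | ρ)**, via the inclusion. -/
theorem wildSharpDefectZeroInitAt_one_algUltraIrr (hRoy : Roy2014_thm_1_1) {ρ : ℝ} (hρ : AlgUltraLiouvilleIrr ρ) :
    WildSharpDefectZeroInitAt 1 ![(1 : ℝ), ρ] :=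
  wildSharpDefectZeroInitAt_one_algUltra hRoy hρ.algUltraLiouville

end Cells

/-! ## §M  THE NAMED MEMBER: g40's `ρ_A` is in `AlgUltraLiouvilleIrr` (hypothesis-free) -/

section Member

/-- **IRREDUCIBILITY of the member polynomials over `ℚ`**: `f_K = (a_K X − P_K)^{g_K} − 2` has `f_K(β_K) = 0`,
`deg f_K ≤ g_K = [ℚ(β_K) : ℚ]` (g40's degree certificate `finrank_adjoin_theta` / `adjoin_betaSeq_eq`), so
`f_K = lead · minpoly_ℚ(β_K)` is irreducible. -/
theorem irreducible_fSeq_map (K : ℕ) : Irreducible ((fSeq K).map (Int.castRingHom ℚ)) := by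
  obtain ⟨p, hp⟩ : ∃ p : Polynomial ℚ, p = (fSeq K).map (Int.castRingHom ℚ) := ⟨_, rfl⟩
  have hp0 : p ≠ 0 := by
    rw [hp]; exact (Polynomial.map_ne_zero_iff (Int.castRingHom ℚ).injective_int).mpr (fSeq_ne_zero K)
  have hpz : Polynomial.aeval (betaSeq K) p = 0 := by rw [hp, aeval_map_int, aeval_betaSeq_fSeq]
  have halg : IsAlgebraic ℚ (betaSeq K) := ⟨p, hp0, hpz⟩
  have hint : IsIntegral ℚ (betaSeq K) := halg.isIntegral
  have hdeg : (minpoly ℚ (betaSeq K)).natDegree = gdeg K := by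
    rw [← IntermediateField.adjoin.finrank hint, adjoin_betaSeq_eq, finrank_adjoin_theta]
  have hpdeg : p.natDegree ≤ (minpoly ℚ (betaSeq K)).natDegree := by
    rw [hdeg, hp, Polynomial.natDegree_map_eq_of_injective (Int.castRingHom ℚ).injective_int]
    exact natDegree_fSeq_le K
  have hdvd : minpoly ℚ (betaSeq K) ∣ p := minpoly.dvd ℚ _ hpz
  have heq := Polynomial.eq_leadingCoeff_mul_of_monic_of_dvd_of_natDegree_le (minpoly.monic hint) hdvd hpdeg
  rw [← hp, heq]
  exact (irreducible_isUnit_mul (Polynomial.isUnit_C.mpr (isUnit_iff_ne_zero.mpr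
    (Polynomial.leadingCoeff_ne_zero.mpr hp0)))).mpr (minpoly.irreducible hint)

/-- **MEMBERSHIP (hypothesis-free)**: `ρ_A ∈ AlgUltraLiouvilleIrr` — g40's certificate chain plus
`irreducible_fSeq_map` and `β_K < ρ_A` (`betaSeq_lt_rhoA`). -/
theorem algUltraLiouvilleIrr_rhoA : AlgUltraLiouvilleIrr rhoA := by
  intro m
  refine ⟨betaSeq m, fSeq m, ASeq m, le_ASeq m, irrational_betaSeq m, irreducible_fSeq_map m,
    natDegree_fSeq_le_ASeq m, abs_coeff_fSeq_le m, aeval_betaSeq_fSeq m, (betaSeq_lt_rhoA m).ne, ?_⟩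
  have h1 := abs_rhoA_sub_betaSeq_le m
  have h2 := four_div_aN_succ_lt m
  have hA1 : (1 : ℝ) ≤ ASeq m := by exact_mod_cast one_le_ASeq m
  have h3 : Real.exp (-Real.exp ((ASeq m : ℝ) ^ (m + 1))) ≤ Real.exp (-Real.exp ((ASeq m : ℝ) ^ m)) := by
    rw [Real.exp_le_exp, neg_le_neg_iff, Real.exp_le_exp]
    exact pow_le_pow_right₀ hA1 (Nat.le_succ m)
  exact lt_of_le_of_lt h1 (lt_of_lt_of_le h2 h3)

/-- **THE MEMBER CELL: `t(1, ρ_A) = 5` mod Roy** — `ρ_A, e, e^{ρ_A}, e^{i}, e^{iρ_A}` algebraically independent,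
at a point outside every bounded-degree class of record (`rhoA_position`). -/
theorem five_le_polarDeg_one_rhoA (hRoy : Roy2014_thm_1_1) :
    ((5 : ℕ) : Cardinal) ≤ polarDeg ![(1 : ℝ), rhoA] :=
  five_le_polarDeg_one_of_algUltraIrr hRoy algUltraLiouvilleIrr_rhoA

/-- … swapped column `(ρ_A | 1)`. -/
theorem five_le_polarDeg_swap_rhoA (hRoy : Roy2014_thm_1_1) :
    ((5 : ℕ) : Cardinal) ≤ polarDeg ![rhoA, (1 : ℝ)] :=
  five_le_polarDeg_swap_of_algUltraIrr hRoy algUltraLiouvilleIrr_rhoA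

/-- The algebraic independence itself at `ρ_A`, mod Roy. -/
theorem algebraicIndependent_cons_rhoA (hRoy : Roy2014_thm_1_1) :
    AlgebraicIndependent ℚ (Fin.cons (rhoA : ℂ) (fun j => cexp (qpt rhoA j)) : Fin (4 + 1) → ℂ) :=
  algebraicIndependent_cons_of_algUltraIrr hRoy algUltraLiouvilleIrr_rhoA

/-- The surplus at `ρ_A` in the VERBATIM shape of the body of item 24622 (`m = 2`, `r = (1, ρ_A)`), mod Roy. -/
theorem kleinPolarSchanuel_body_two_one_rhoA_surplus (hRoy : Roy2014_thm_1_1) :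
    ((2 + 2 + 1 : ℕ) : Cardinal) ≤ Algebra.trdeg ℚ ↥(IntermediateField.adjoin ℚ
      (Set.range (Fin.append (fun j => ((![(1 : ℝ), rhoA] j : ℝ) : ℂ)) (fun j => ((![(1 : ℝ), rhoA] j : ℝ) : ℂ) * Complex.I)) ∪
        Set.range (Complex.exp ∘ Fin.append (fun j => ((![(1 : ℝ), rhoA] j : ℝ) : ℂ))
          (fun j => ((![(1 : ℝ), rhoA] j : ℝ) : ℂ) * Complex.I)))) :=
  five_le_polarDeg_one_rhoA hRoy

/-- **POSITION of `ρ_A`** (hypothesis-free): in the NEW class, and — by the tree's `rhoA_position` — transcendental,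
in none of the earlier `(1|ρ)`-cell classes and in no bounded-degree hyper class `DegHyperLiouville d`. -/
theorem rhoA_position_irr :
    AlgUltraLiouvilleIrr rhoA ∧ Transcendental ℚ rhoA ∧
      ¬ Summit.Schanuel.Schanuel.Theorems.RootDecomp1KHyper.HyperCell.HyperLiouville rhoA ∧
      ¬ QuadHyperLiouville rhoA ∧
      ¬ Summit.Schanuel.Schanuel.Theorems.RootDecomp1BRadicalDescent.UltraLiouville rhoA ∧
      ¬ Summit.Schanuel.Schanuel.Theorems.RootDecomp1EPointTransfer.UltraLiouville rhoA ∧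
      ¬ Summit.Schanuel.Schanuel.Theorems.RootDecomp1KGeneric.LiouvilleOrder 8 rhoA ∧
      (∀ k, 4 ≤ k → ¬ Summit.Schanuel.Schanuel.Theorems.RootDecomp1KGeneric.LiouvilleOrder k rhoA) ∧
      (∀ d, ¬ DegHyperLiouville d rhoA) :=
  ⟨algUltraLiouvilleIrr_rhoA, rhoA_position.2⟩

end Member

end Summit.Schanuel.Schanuel.Theorems.RootDecomp1BResFrame

end
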